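import Mathlib
import Summits.AtomisticToContinuum.Crystallization.Theses.PhononSlackCertificates
import Summits.AtomisticToContinuum.Crystallization.Theorems.PhononSlackCertificatesAllBadGapFloor
import Summits.AtomisticToContinuum.Crystallization.Theorems.LayeredLawsSelectHcp.Negative.Threshold

/-!
# Route `PhononSlackCertificates`, crux `NearFieldConvexity` (stmt-AtomisticToContinuum-13958), line `Sketch`:
stub `stub_selfSiteFloor`

The BOUNDARY FLOOR used by the bookkeeping of skeleton v9: for a `δ`-separated configuration `x`
(`δ > 0`), any finite set `Ω` of particles and any particle `i`, the self-site excess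
`½ Σ_{j ∈ Ω ∖ i} V_LJ(|x i − x j|) − e*` is `≥ −(250/12)·δ⁻⁶`, where
`V_LJ r = (1/12) r⁻¹² − (1/6) r⁻⁶` (`lennardJones`) and `e* = ⨅ Q, Q.energyPerParticle lennardJones`
over periodic configurations of `ℝ³`.

Proof: drop the repulsion termwise (`neg_inv_pow_six_le_lennardJones`, `V_LJ r ≥ −r⁻⁶/6`), enlarge
`Ω.erase i` to `univ.erase i` on the nonnegative terms `r⁻⁶`, apply the shell sum
`sum_inv_pow_six_le` (`Σ_{k ≠ i} |x i − x k|⁻⁶ ≤ 250·δ⁻⁶`), halve, and use `e* ≤ −1/2 ≤ 0`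
(`LayeredLawsSelectHcp.Negative.Threshold.eStar_le_neg_half`, `eStar` being by definition the infimum
above).  Nothing about goodness / layering of `Ω` is used or stated here.
-/

noncomputable section

open scoped BigOperators
open Literature.MathematicalPhysics.StatisticalMechanics Literature.Geometry.DiscreteGeometry

namespace Summit.AtomisticToContinuum.Crystallization.Theorems.PhononSlackNearFieldConvexity

/-- **Partial site energies of `δ`-separated configurations.**  For any finite set `Ω` of particles
and any `i`, `∑_{j ∈ Ω ∖ i} V_LJ(|xᵢ − xⱼ|) ≥ −(250/6)·δ⁻⁶`: drop the repulsion termwise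
(`V_LJ r ≥ −r⁻⁶/6`), the nonnegative terms `r⁻⁶` only increase when `Ω.erase i` is enlarged to
`univ.erase i`, then the shell sum `sum_inv_pow_six_le`. [folklore] -/
theorem selfSiteFloor_neg_le_partialSiteEnergy {N : ℕ} (x : Fin N → EuclideanSpace ℝ (Fin 3))
    {δ : ℝ} (hδ : 0 < δ) (hsep : ∀ i j : Fin N, i ≠ j → δ ≤ dist (x i) (x j))
    (Ω : Finset (Fin N)) (i : Fin N) :
    -(250 / 6 * δ⁻¹ ^ 6) ≤ ∑ j ∈ Ω.erase i, lennardJones (dist (x i) (x j)) := by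
  have hS := sum_inv_pow_six_le x hδ hsep i
  have hsub : Ω.erase i ⊆ Finset.univ.erase i :=
    Finset.erase_subset_erase i (Finset.subset_univ Ω)
  have hmono : ∑ j ∈ Ω.erase i, (dist (x i) (x j))⁻¹ ^ 6 ≤
      ∑ k ∈ Finset.univ.erase i, (dist (x i) (x k))⁻¹ ^ 6 :=
    Finset.sum_le_sum_of_subset_of_nonneg hsub fun k _ _ => by positivity
  calc -(250 / 6 * δ⁻¹ ^ 6) ≤ -(1 / 6) * ∑ j ∈ Ω.erase i, (dist (x i) (x j))⁻¹ ^ 6 := by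
        linarith
    _ = ∑ j ∈ Ω.erase i, -(1 / 6 * (dist (x i) (x j))⁻¹ ^ 6) := by
        rw [Finset.mul_sum]
        refine Finset.sum_congr rfl fun j _ => ?_
        ring
    _ ≤ ∑ j ∈ Ω.erase i, lennardJones (dist (x i) (x j)) :=
        Finset.sum_le_sum fun j _ =>
          Summit.AtomisticToContinuum.Crystallization.Theorems.PhononSlackCertificatesAllBadGapFloor.neg_inv_pow_six_le_lennardJones
            _

/-- **Stub `stub_selfSiteFloor` (SELF-SITE FLOOR).**  For a `δ`-separated configuration (`δ > 0`),
any `Ω` and any `i`, the self-site excess is bounded below: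
`½ Σ_{j ∈ Ω ∖ i} V_LJ(|x i − x j|) − e* ≥ −(250/12)·δ⁻⁶`
(`selfSiteFloor_neg_le_partialSiteEnergy` halved, and `e* ≤ −1/2 ≤ 0` by
`LayeredLawsSelectHcp.Negative.Threshold.eStar_le_neg_half`). [folklore] -/
theorem stub_selfSiteFloor :
    ∀ (N : ℕ) (x : Fin N → EuclideanSpace ℝ (Fin 3)) (δ : ℝ), 0 < δ →
      (∀ i j : Fin N, i ≠ j → δ ≤ dist (x i) (x j)) →
      ∀ (Ω : Finset (Fin N)) (i : Fin N),
        -(250 / 12 * δ⁻¹ ^ 6) ≤ (1 / 2 : ℝ) * (∑ j ∈ Ω.erase i, lennardJones (dist (x i) (x j))) -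
          (⨅ Q : PeriodicConfiguration 3, Q.energyPerParticle lennardJones) := by
  intro N x δ hδ hsep Ω i
  have h1 := selfSiteFloor_neg_le_partialSiteEnergy x hδ hsep Ω i
  have h2 : (⨅ Q : PeriodicConfiguration 3, Q.energyPerParticle lennardJones) ≤ -1 / 2 :=
    Summit.AtomisticToContinuum.Crystallization.Theorems.LayeredLawsSelectHcp.Negative.Threshold.eStar_le_neg_half
  linarith

end Summit.AtomisticToContinuum.Crystallization.Theorems.PhononSlackNearFieldConvexity
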